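import Mathlib

/-!
# p5 — the certificate predicate for the Remark 5.7.1″-form identities of the lattice-closure set of record

`IsCert c` bundles, for one certificate `c` of proofs/p1-scripts/lattice-closure-v1.1/fl_certs_5711.json or
fl_certs_extra_5711.json (p1 (g4); the note proofs/P1-FermatLatticeClosure-v1.1.md §1–§3; the form of p6-fermat-reach.md
Remark 5.7.1″), the finite checks of p1's from-scratch checker fl_check5711.py together with (R1), (R3), (R4) of fl_verify.py:

* Φ is the CM type Φ_(a,b) = {t a unit of ℤ/m : ⟨ta/m⟩ + ⟨tb/m⟩ < 1} of the Fermat coordinate α = (a, b, c), a + b + c ≡ 0,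
  gcd(a, b, c, m) = 1, and Φ_(a,b) contains exactly one of t, −t for every unit t (`PhiOK`, `AlphaOK`);
* Q is a pair-free set of units and a Hodge set: |Q ∩ uΦ| = |Q|/2 for every unit u (`QOK`, written through the Fermat
  coordinate: s ∈ uΦ ⟺ u⁻¹s ∈ Φ_(a,b), and v = u⁻¹ runs over the units with u);
* γ = k·Q·α is the multiset of the residues k·t·x mod M (t ∈ Q, x ∈ α; M = k·m) (`gammaOf`);
* δ and δ′ are juxtapositions of cancelling pairs (x, −x), x ≢ 0 mod M (`PairsOK`);
* the identity γ·δ = β₁⋯β_l·δ′ holds as an equality of multisets of residues mod M (`BoundedPerm`: every residue r < M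
  occurs equally often on both sides — which is the `Multiset` equality, `BoundedPerm.multiset_eq`);
* every block β is legitimate at its level m′ | M (`Block.Legit`): its multiset is the pull-back by M/m′ of the Galois
  translate t·base (t a unit mod M), and t·base is a Hodge 4-multiset, a split Hodge 6-multiset, one of Aoki's standard
  elements σ_{p,i} (p an odd prime dividing m′, d = m′/p > 2, gcd(i, d) = 1; a Hodge multiset), or a cancelling pair.

`IsCert` is decidable for concrete data (the multiset equalities are decided through the residue code Σ B^x, base
B = length + 2, whose injectivity on bounded histograms is `code_inj`, from `Nat.ofDigits_inj_of_len_eq`); each instance in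
the P5LatticeClosureCerts* modules is closed by `decide`.
NOT certified here: the identification of the JSON atoms with the note's objects, the generation of the exceptional lattice
by the Q's ((R2) of fl_verify.py), the group / Galois theory behind the block kinds, and anything Hodge-theoretic (Aoki 1987
Thm 1-4, Shioda 1981 Lemmas 4.1–4.2 are cited by the note, not by this file).
-/

namespace HodgeRepro0.P5.LatticeClosureCert

/-- the units of ℤ/m, listed as naturals 0 < t < m with gcd(t, m) = 1 -/
def unitsOf (m : ℕ) : List ℕ := (List.range m).filter (fun t => 0 < t ∧ Nat.gcd t m = 1)

/-- trial-division primality (structural recursion only, so that `decide` reduces it in the kernel) -/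
def isPrime (q : ℕ) : Bool := decide (2 ≤ q) && (List.range q).all (fun r => decide (r < 2 ∨ q % r ≠ 0))

/-- both entries of every pair, as one list -/
def pairEntries (d : List (ℕ × ℕ)) : List ℕ := d.flatMap (fun p => [p.1, p.2])

/-- `BoundedPerm M l₁ l₂`: every entry of both lists is < M and every residue r < M occurs equally often in both lists —
the equality of `l₁` and `l₂` as multisets of residues mod M (see `BoundedPerm.multiset_eq`) -/
def BoundedPerm (M : ℕ) (l₁ l₂ : List ℕ) : Prop :=
  (∀ x ∈ l₁, x < M) ∧ (∀ x ∈ l₂, x < M) ∧ ∀ r ∈ List.range M, l₁.count r = l₂.count r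

/-- `BoundedPerm` is multiset equality -/
theorem BoundedPerm.multiset_eq {M : ℕ} {l₁ l₂ : List ℕ} (h : BoundedPerm M l₁ l₂) :
    ((l₁ : List ℕ) : Multiset ℕ) = ((l₂ : List ℕ) : Multiset ℕ) := by
  obtain ⟨h₁, h₂, hc⟩ := h
  rw [Multiset.coe_eq_coe, List.perm_iff_count]
  intro a
  by_cases ha : a < M
  · exact hc a (List.mem_range.mpr ha)
  · have n₁ : a ∉ l₁ := fun hm => ha (h₁ a hm)
    have n₂ : a ∉ l₂ := fun hm => ha (h₂ a hm)
    rw [List.count_eq_zero.mpr n₁, List.count_eq_zero.mpr n₂]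

/-- the residue code Σ_{x ∈ l} B^x of a list of residues -/
def code (B : ℕ) (l : List ℕ) : ℕ := (l.map (fun x => B ^ x)).sum

/-- `Nat.ofDigits` of a list indexed by `List.range M` is the corresponding power sum -/
theorem ofDigits_range_map (B M : ℕ) (g : ℕ → ℕ) :
    Nat.ofDigits B ((List.range M).map g) = ∑ r ∈ Finset.range M, g r * B ^ r := by
  induction M with
  | zero => simp
  | succ n ih =>
    rw [List.range_succ, List.map_append, Nat.ofDigits_append, ih, Finset.sum_range_succ]
    simp [Nat.ofDigits_singleton, mul_comm]

/-- the residue code is the histogram's power sum -/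
theorem code_eq_sum (B M : ℕ) (l : List ℕ) (hl : ∀ x ∈ l, x < M) :
    code B l = ∑ r ∈ Finset.range M, l.count r * B ^ r := by
  unfold code
  rw [Finset.sum_list_map_count]
  simp only [smul_eq_mul]
  apply Finset.sum_subset
  · intro x hx
    exact Finset.mem_range.mpr (hl x (List.mem_toFinset.mp hx))
  · intro x _ hx
    rw [List.mem_toFinset] at hx
    simp [List.count_eq_zero.mpr hx]

/-- the residue code in base 1 is the length -/
theorem code_one (l : List ℕ) : code 1 l = l.length := by
  simp [code]

/-- two lists of residues < M with histograms below B and equal residue codes in base B have equal histograms -/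
theorem code_inj {B M : ℕ} (hB : 1 < B) {l₁ l₂ : List ℕ} (h₁ : ∀ x ∈ l₁, x < M) (h₂ : ∀ x ∈ l₂, x < M)
    (c₁ : ∀ r, l₁.count r < B) (c₂ : ∀ r, l₂.count r < B) (h : code B l₁ = code B l₂) :
    ∀ r ∈ List.range M, l₁.count r = l₂.count r := by
  have e : (List.range M).map (fun r => l₁.count r) = (List.range M).map (fun r => l₂.count r) := by
    apply Nat.ofDigits_inj_of_len_eq hB
    · simp
    · intro d hd
      obtain ⟨r, _, rfl⟩ := List.mem_map.mp hd
      exact c₁ r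
    · intro d hd
      obtain ⟨r, _, rfl⟩ := List.mem_map.mp hd
      exact c₂ r
    · rw [ofDigits_range_map, ofDigits_range_map, ← code_eq_sum B M l₁ h₁, ← code_eq_sum B M l₂ h₂]
      exact h
  exact List.map_inj_left.mp e

/-- the decision procedure for `BoundedPerm`: the bounds, equal lengths, equal residue codes in base length + 2 -/
def boundedPermB (M : ℕ) (l₁ l₂ : List ℕ) : Bool :=
  l₁.all (fun x => decide (x < M)) && l₂.all (fun x => decide (x < M)) &&
    (l₁.length == l₂.length) && (code (l₁.length + 2) l₁ == code (l₁.length + 2) l₂)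

/-- the decision procedure decides `BoundedPerm` -/
theorem boundedPermB_iff (M : ℕ) (l₁ l₂ : List ℕ) : boundedPermB M l₁ l₂ = true ↔ BoundedPerm M l₁ l₂ := by
  unfold boundedPermB BoundedPerm
  simp only [Bool.and_eq_true, List.all_eq_true, decide_eq_true_eq, beq_iff_eq]
  constructor
  · rintro ⟨⟨⟨h₁, h₂⟩, hlen⟩, hc⟩
    refine ⟨h₁, h₂, code_inj (B := l₁.length + 2) (M := M) (by omega) h₁ h₂ ?_ ?_ hc⟩
    · intro r
      have := List.count_le_length (a := r) (l := l₁)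
      omega
    · intro r
      have := List.count_le_length (a := r) (l := l₂)
      omega
  · rintro ⟨h₁, h₂, hc⟩
    have hsum : ∀ B : ℕ, code B l₁ = code B l₂ := by
      intro B
      rw [code_eq_sum B M l₁ h₁, code_eq_sum B M l₂ h₂]
      exact Finset.sum_congr rfl (fun r hr => by rw [hc r (List.mem_range.mpr (Finset.mem_range.mp hr))])
    have hlen : l₁.length = l₂.length := by
      rw [← code_one l₁, ← code_one l₂]
      exact hsum 1
    exact ⟨⟨⟨h₁, h₂⟩, hlen⟩, hsum _⟩

/-- `BoundedPerm` is decidable (through the residue code) -/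
instance (M : ℕ) (l₁ l₂ : List ℕ) : Decidable (BoundedPerm M l₁ l₂) :=
  decidable_of_iff _ (boundedPermB_iff M l₁ l₂)

/-- `IsHodge m′ ms`: a Hodge multiset of residues at level m′ — even size, no entry ≡ 0, zero sum, and Hodge weight
|ms|/2 under every unit t (Σ (t·x mod m′) = (|ms|/2)·m′) -/
def IsHodge (m' : ℕ) (ms : List ℕ) : Prop :=
  ms.length % 2 = 0 ∧ (∀ x ∈ ms, x % m' ≠ 0) ∧ ms.sum % m' = 0 ∧
  ∀ t ∈ unitsOf m', (ms.map (fun x => t * x % m')).sum = (ms.length / 2) * m'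

/-- `IsHodge` is decidable -/
instance (m' : ℕ) (ms : List ℕ) : Decidable (IsHodge m' ms) := by delta IsHodge; infer_instance

/-- Aoki's standard element σ_{p,i} of level m′ = p·d: the residues i + j·d (0 ≤ j < p) and −p·i -/
def stdSigma (m' p i : ℕ) : List ℕ :=
  (List.range p).map (fun j => (i + j * (m' / p)) % m') ++ [(m' - p * i % m') % m']

/-- `IsStd m′ ms`: ms is σ_{p,i} for some odd prime p | m′ with d = m′/p > 2 and some 0 < i with gcd(i, d) = 1
(i is an entry of σ_{p,i}, so it is searched among the entries of ms) -/
def IsStd (m' : ℕ) (ms : List ℕ) : Prop :=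
  ∃ p ∈ (List.range (m' + 1)).filter (fun p => 3 ≤ p ∧ isPrime p = true ∧ m' % p = 0 ∧ 2 < m' / p),
    ∃ i ∈ ms, 0 < i ∧ Nat.gcd i (m' / p) = 1 ∧ BoundedPerm m' ms (stdSigma m' p i)

/-- `IsStd` is decidable -/
instance (m' : ℕ) (ms : List ℕ) : Decidable (IsStd m' ms) := by delta IsStd; infer_instance

/-- the kind of a block: a Hodge 4-multiset, a split Hodge 6-multiset, a standard element σ_{p,i}, a cancelling pair -/
inductive Kind
  | four | six | std | pair
  deriving DecidableEq, Repr

/-- a block of the identity: its level m′ (a divisor of M), its kind, its base multiset at level m′, the unit translate t,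
and its multiset at level M (the pull-back of t·base by M/m′) -/
structure Block where
  /-- the level m′ -/
  level : ℕ
  /-- the kind -/
  kind : Kind
  /-- the base multiset at level m′ -/
  base : List ℕ
  /-- the unit translate -/
  t : ℕ
  /-- the multiset at level M -/
  multiset : List ℕ
  deriving Repr

/-- the Galois translate t·base at the block's level -/
def Block.tbase (b : Block) : List ℕ := b.base.map (fun x => b.t * x % b.level)

/-- `Block.Legit M b`: the block is legitimate at level M — its level divides M, its translate is a unit, its multiset is
the pull-back of t·base, and t·base is of its kind -/
def Block.Legit (M : ℕ) (b : Block) : Prop :=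
  0 < b.level ∧ M % b.level = 0 ∧ Nat.gcd b.t M = 1 ∧
  BoundedPerm M b.multiset (b.tbase.map (fun x => (M / b.level) * x % M)) ∧
  ((b.kind = .pair ∧ b.tbase.length = 2 ∧ b.tbase.sum % b.level = 0 ∧ b.tbase.headD 0 % b.level ≠ 0) ∨
   (b.kind = .four ∧ b.tbase.length = 4 ∧ IsHodge b.level b.tbase) ∨
   (b.kind = .six ∧ b.tbase.length = 6 ∧ IsHodge b.level b.tbase ∧
      ∃ i ∈ [1, 2, 3, 4, 5], ∃ j ∈ [1, 2, 3, 4, 5], i < j ∧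
        (b.tbase.headD 0 + b.tbase.getD i 0 + b.tbase.getD j 0) % b.level = 0) ∨
   (b.kind = .std ∧ IsHodge b.level b.tbase ∧ IsStd b.level b.tbase))

/-- `Block.Legit` is decidable -/
instance (M : ℕ) (b : Block) : Decidable (Block.Legit M b) := by delta Block.Legit; infer_instance

/-- `PhiOK m α Φ`: Φ (listed increasingly) is the CM type Φ_(a,b) = {t a unit : ⟨ta/m⟩ + ⟨tb/m⟩ < 1} of the Fermat
coordinate α = (a, b, c), and Φ_(a,b) contains exactly one of t, m − t for every unit t -/
def PhiOK (m : ℕ) (alpha Phi : List ℕ) : Prop :=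
  Phi = (unitsOf m).filter (fun t => t * alpha.getD 0 0 % m + t * alpha.getD 1 0 % m < m) ∧
  ∀ t ∈ unitsOf m, ((t * alpha.getD 0 0 % m + t * alpha.getD 1 0 % m < m) ↔
    ¬ ((m - t) * alpha.getD 0 0 % m + (m - t) * alpha.getD 1 0 % m < m))

/-- `PhiOK` is decidable -/
instance (m : ℕ) (alpha Phi : List ℕ) : Decidable (PhiOK m alpha Phi) := by delta PhiOK; infer_instance

/-- `AlphaOK m α`: α = (a, b, c) with a + b + c ≡ 0 mod m and gcd(a, b, c, m) = 1 -/
def AlphaOK (m : ℕ) (alpha : List ℕ) : Prop :=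
  alpha.length = 3 ∧ alpha.sum % m = 0 ∧
  Nat.gcd (Nat.gcd (alpha.getD 0 0) (alpha.getD 1 0)) (Nat.gcd (alpha.getD 2 0) m) = 1

/-- `AlphaOK` is decidable -/
instance (m : ℕ) (alpha : List ℕ) : Decidable (AlphaOK m alpha) := by delta AlphaOK; infer_instance

/-- `QOK m α Q`: Q is a pair-free set of units of ℤ/m and a Hodge set — |Q ∩ uΦ| = |Q|/2 for every unit u, written
through the Fermat coordinate: s ∈ uΦ_(a,b) ⟺ ⟨u⁻¹sa/m⟩ + ⟨u⁻¹sb/m⟩ < 1, with v = u⁻¹ running over the units -/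
def QOK (m : ℕ) (alpha Q : List ℕ) : Prop :=
  (∀ s ∈ Q, 0 < s ∧ s < m ∧ Nat.gcd s m = 1 ∧ ¬ ((m - s) ∈ Q)) ∧
  ∀ v ∈ unitsOf m,
    2 * (Q.filter (fun s => v * s * alpha.getD 0 0 % m + v * s * alpha.getD 1 0 % m < m)).length = Q.length

/-- `QOK` is decidable -/
instance (m : ℕ) (alpha Q : List ℕ) : Decidable (QOK m alpha Q) := by delta QOK; infer_instance

/-- `PairsOK M d`: every pair of d is a cancelling pair (x, −x) with x ≢ 0 mod M -/
def PairsOK (M : ℕ) (d : List (ℕ × ℕ)) : Prop := ∀ p ∈ d, p.1 % M ≠ 0 ∧ (p.1 + p.2) % M = 0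

/-- `PairsOK` is decidable -/
instance (M : ℕ) (d : List (ℕ × ℕ)) : Decidable (PairsOK M d) := by delta PairsOK; infer_instance

/-- the multiset γ = k·Q·α: the residues k·t·x mod M, t ∈ Q, x ∈ α -/
def gammaOf (M k : ℕ) (Q alpha : List ℕ) : List ℕ := (Q.map (fun t => alpha.map (fun x => k * t * x % M))).flatten

/-- one certificate in Remark 5.7.1″ form: the degree m, the multiplier k and the level M = k·m, the CM type Φ, the Hodge set
Q, the Fermat coordinate α, the pairs δ, the blocks β₁ … β_l, the pairs δ′ (γ = k·Q·α is computed) -/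
structure Cert where
  /-- the degree m -/
  m : ℕ
  /-- the multiplier k -/
  k : ℕ
  /-- the level M = k·m -/
  M : ℕ
  /-- the CM type Φ -/
  Phi : List ℕ
  /-- the Hodge set Q -/
  Q : List ℕ
  /-- the Fermat coordinate α = (a, b, c) -/
  alpha : List ℕ
  /-- the pairs δ -/
  delta : List (ℕ × ℕ)
  /-- the blocks β₁ … β_l -/
  blocks : List Block
  /-- the pairs δ′ -/
  delta' : List (ℕ × ℕ)

/-- the certificate predicate: M = k·m, Φ = Φ_(a,b) a CM type, α a Fermat coordinate, Q a pair-free Hodge set, δ and δ′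
cancelling pairs, the identity γ·δ = β₁⋯β_l·δ′ of multisets of residues mod M with γ = k·Q·α, every block legitimate -/
def IsCert (c : Cert) : Prop :=
  c.M = c.k * c.m ∧ 0 < c.k ∧ PhiOK c.m c.alpha c.Phi ∧ AlphaOK c.m c.alpha ∧ QOK c.m c.alpha c.Q ∧
  PairsOK c.M c.delta ∧ PairsOK c.M c.delta' ∧
  BoundedPerm c.M (gammaOf c.M c.k c.Q c.alpha ++ pairEntries c.delta)
    ((c.blocks.map Block.multiset).flatten ++ pairEntries c.delta') ∧
  ∀ b ∈ c.blocks, Block.Legit c.M b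

/-- `IsCert` is decidable -/
instance (c : Cert) : Decidable (IsCert c) := by delta IsCert; infer_instance

/-- sanity instance: row 0 of the scan table (m = 21, Φ = Φ_(9,11), Q = {2, 5, 8, 11, 17, 20}; γ = Q·α is itself a
juxtaposition of pairs, no block) -/
theorem row0_cert0 : IsCert ⟨21, 1, 21, [1, 2, 4, 5, 8, 10], [2, 5, 8, 11, 17, 20], [9, 11, 1], [], [],
    [(1, 20), (2, 19), (3, 18), (4, 17), (5, 16), (6, 15), (8, 13), (9, 12), (10, 11)]⟩ := by decide +kernel

end HodgeRepro0.P5.LatticeClosureCert
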